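import Summits.KontsevichZagierPeriods.Zeta5Search.Barrier.ConeGammaTranslateGradient

/-!
# ζ(5) search — BARRIER: THE FIRST MOMENTS OF THE JUMPS ARE THE TILT RESPONSE — one period of the TILTED translate
# against the rigid translate, exactly (the object of S-E's within-period drift term)

HONEST FRAMING (cell `pub-zeta5`): systematic search; no irrationality claim unless kernel-certified. MODEL objects
under Brown–Zudilin's (28)+(30) accounting ([BZ22] = arXiv:2210.03391; (28) observed, not proved); nothing here is a
statement about `ζ(5)`, any `γ` of record, the cone's supremum (C2 OPEN) or the value / sign of any jump or moment at a
named direction (DATA of the cell); NO cancellation is quantified; S-E / (TD_A) stay CONJECTURED; records in print UNMOVED.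
Prover P2 g40 (item «THE SIGNED JUMP MASSES», file (3); plan INBOX 2026-08-28 l.9814). Source: lead/lit g27 `SE-DESK-NOTE.md`
§2 (the within-period DRIFT `A_k(s) = 𝒩(sω₀ + δ_k + εs v̂) − 𝒩(sω₀ + δ_k)`) and §3(ii) («signed `∫A_k ds ≈ −ε Σ_f (φ_f(v̂)/x_f)
Σ_{c∈f} J_c s_c`, i.e. jump signs against crossing POSITIONS within one period, per wall family» — where S-E needs cancellation).

With the setting and the margin hypotheses of `ConeGammaTranslateGradient` (all forms of `a` positive, `T > 0` a period,
the translate `δ` generic with margin `r`: `hsep`, `hend`), the crossings `s_{k,z} = (z − φ_kδ)/h_k(a)`, `z ∈ S_k`, their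
jumps `J_{k,z}` and the FIRST MOMENTS **`m_k(δ) = Σ_{z∈S_k} s_{k,z}·J_{k,z}`** (written out; no def), for every TILT `η` of
the direction with `T·|φ_k(η)| ≤ r·h_k(a)/4`:
* `integral_floor_line_window` — one floor over a window holding one crossing: `∫_α^β ⌊u·x + c⌋ du = (z₀−1)(s₀−α) + z₀(β−s₀)`;
  `integral_window_tilt` — hence the window integral of the TILTED floor against the straight one is `J·(s₀ − s₀')`,
  `s₀' = (z − φ_kδ)/(h_k + φ_kη)` the tilted crossing time: **the crossing at `s₀` moves by `s₀·φ_k(η)/(h_k + φ_k(η))`** —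
  proportionally to its POSITION in the period — and carries its jump with it;
* **`integral_tilt_sub_eq_sum_firstMoment` — THE TILT THEOREM**:
  **`∫₀ᵀ [𝒩(u·(s(a) + η) + δ) − 𝒩(u·s(a) + δ)] du = Σ_k (φ_k(η)/(h_k(a) + φ_k(η)))·m_k(δ)`** — EXACT; the pointwise response
  is file (2b)'s window sum at the `u`-dependent displacement `Δ = u·η` (`torusN_sub_eq_sum_windows`), integrated window by
  window. This is the desk note's `∫A_k ds` at the translate `δ = δ_k`, with its `≈` an `=` and `x_f` replaced by the tilted
  rate `x_f + φ_f(η)`;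
* `abs_firstMoment_le` (`|m_k| ≤ T·(T·h_k)`: positions `≤ T`, jumps `0/±1`), **`abs_integral_tilt_sub_le`** —
  `|∫₀ᵀ …| ≤ (4/3)·T²·Σ_k |φ_k η|`: the no-cancellation drift bound of `ConeGammaCrossings` (`εT·T·Σ|φ_k|`, up to the factor
  `4/3` from the tilted rates) is the case of NO cancellation in the first moments; the size of `m_k(δ_k)` — «jump signs
  against crossing positions» — is S-E's drift constant, DATA, in no statement.
* **`period_integral_eq_translate_add_tilt`** — consequently the `n`-th PERIOD of the perturbed orbit of `a' = aOfS(s(a) + η)`,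
  unweighted, is EXACTLY `∫_{nT}^{(n+1)T} [𝒩(u·s(a')) − 𝒩(u·s(a))] du = [P(δ_n) − P(0)] + Σ_k (φ_kη/(h_k + φ_kη))·m_k(δ_n)`,
  `δ_n = (nT)·η` — the desk note's split `B_n + A_n` of one period with BOTH parts finite expressions in the jumps of the
  translated orbit (whenever `δ_n` is generic with margin `r` and `T·|φ_kη| ≤ r·h_k/4` — which forces `n ≥ 4`: the first
  periods, the coherence regime of the closed orbit's junctions (P2 g19–g33), are NOT covered).
NOT here (honest): anything at a named direction; the `u⁻²` weight; the flow average of `m_k`; `Φ`, `γ`, C2, S-E, `ζ(5)`.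
-/

noncomputable section

open Set MeasureTheory
open scoped Topology

namespace Summit.KontsevichZagierPeriods.Zeta5Search.Barrier.ConeGamma

/-! ### One floor over a window holding one crossing -/

/-- **One floor over a window holding exactly one crossing.** For `x > 0`, `s₀·x + c = z₀ ∈ ℤ`, `α ≤ s₀ ≤ β` with
`z₀ − 1 ≤ α·x + c` and `β·x + c < z₀ + 1`: `∫_α^β ⌊u·x + c⌋ du = (z₀ − 1)·(s₀ − α) + z₀·(β − s₀)`. -/
theorem integral_floor_line_window {x c s₀ α β : ℝ} {z₀ : ℤ} (hx : 0 < x) (hs₀ : s₀ * x + c = z₀) (hα : α ≤ s₀)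
    (hβ : s₀ ≤ β) (hα1 : (z₀ : ℝ) - 1 ≤ α * x + c) (hβ1 : β * x + c < z₀ + 1) :
    ∫ u in α..β, (⌊u * x + c⌋ : ℝ) = ((z₀ : ℝ) - 1) * (s₀ - α) + z₀ * (β - s₀) := by
  have hI := intervalIntegrable_floor_line hx.le c
  rw [← intervalIntegral.integral_add_adjacent_intervals (b := s₀) (hI α s₀) (hI s₀ β)]
  have h1 : ∫ u in α..s₀, (⌊u * x + c⌋ : ℝ) = ((z₀ : ℝ) - 1) * (s₀ - α) := by
    rw [intervalIntegral.integral_of_le hα, integral_Ioc_eq_integral_Ioo,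
      setIntegral_congr_fun measurableSet_Ioo (g := fun _ : ℝ => ((z₀ : ℝ) - 1)) (fun u hu => by
        have hlt : u * x + c < z₀ := by nlinarith [hu.2]
        have hge : (z₀ : ℝ) - 1 ≤ u * x + c := by nlinarith [hu.1]
        have : ⌊u * x + c⌋ = z₀ - 1 := Int.floor_eq_iff.mpr ⟨by push_cast; linarith, by push_cast; linarith⟩
        simp [this]), ← integral_Ioc_eq_integral_Ioo, ← intervalIntegral.integral_of_le hα,
      intervalIntegral.integral_const, smul_eq_mul]
    ring
  have h2 : ∫ u in s₀..β, (⌊u * x + c⌋ : ℝ) = (z₀ : ℝ) * (β - s₀) := by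
    rw [intervalIntegral.integral_of_le hβ, integral_Ioc_eq_integral_Ioo,
      setIntegral_congr_fun measurableSet_Ioo (g := fun _ : ℝ => (z₀ : ℝ)) (fun u hu => by
        have hge : (z₀ : ℝ) ≤ u * x + c := by nlinarith [hu.1]
        have hlt : u * x + c < z₀ + 1 := by nlinarith [hu.2]
        have : ⌊u * x + c⌋ = z₀ := Int.floor_eq_iff.mpr ⟨hge, hlt⟩
        simp [this]), ← integral_Ioc_eq_integral_Ioo, ← intervalIntegral.integral_of_le hβ,
      intervalIntegral.integral_const, smul_eq_mul]
    ring
  rw [h1, h2]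

/-- **THE WINDOW INTEGRAL OF A TILTED CROSSING.** For rates `x, x' > 0` with `s₀·x + c = z₀ = s₀'·x' + c`, on a window
`[s₀ − ρ, s₀ + ρ]` that holds both crossings with unit-cell margins:
`∫_{s₀−ρ}^{s₀+ρ} (⌊u·x' + c⌋ − ⌊u·x + c⌋) du = s₀ − s₀'` — the crossing moves from `s₀` to `s₀'` and the floor is one
higher in between (with sign). -/
theorem integral_window_tilt {x x' c s₀ s₀' ρ : ℝ} {z₀ : ℤ} (hx : 0 < x) (hx' : 0 < x') (hs₀ : s₀ * x + c = z₀)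
    (hs₀' : s₀' * x' + c = z₀) (hρ : 0 ≤ ρ) (hin : |s₀' - s₀| ≤ ρ)
    (hlo : (z₀ : ℝ) - 1 ≤ (s₀ - ρ) * x + c) (hhi : (s₀ + ρ) * x + c < z₀ + 1)
    (hlo' : (z₀ : ℝ) - 1 ≤ (s₀ - ρ) * x' + c) (hhi' : (s₀ + ρ) * x' + c < z₀ + 1) :
    ∫ u in (s₀ - ρ)..(s₀ + ρ), ((⌊u * x' + c⌋ : ℝ) - ⌊u * x + c⌋) = s₀ - s₀' := by
  have h := abs_le.mp hin
  rw [intervalIntegral.integral_sub (intervalIntegrable_floor_line hx'.le c _ _) (intervalIntegrable_floor_line hx.le c _ _),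
    integral_floor_line_window hx' hs₀' (by linarith) (by linarith) hlo' hhi',
    integral_floor_line_window hx hs₀ (by linarith) (by linarith) hlo hhi]
  ring

/-! ### The tilt theorem -/

/-- The tilted window term is integrable. -/
theorem intervalIntegrable_window_tilt (x x' c s₀ ρ J α β : ℝ) (hx : 0 ≤ x) (hx' : 0 ≤ x') :
    IntervalIntegrable (fun u : ℝ => if |u - s₀| < ρ then J * ((⌊u * x' + c⌋ : ℝ) - ⌊u * x + c⌋) else 0)
      volume α β := by
  have hf : IntervalIntegrable (fun u : ℝ => J * ((⌊u * x' + c⌋ : ℝ) - ⌊u * x + c⌋)) volume α β :=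
    ((intervalIntegrable_floor_line hx' c α β).sub (intervalIntegrable_floor_line hx c α β)).const_mul J
  have heq : (fun u : ℝ => if |u - s₀| < ρ then J * ((⌊u * x' + c⌋ : ℝ) - ⌊u * x + c⌋) else 0) =
      (Ioo (s₀ - ρ) (s₀ + ρ)).indicator fun u => J * ((⌊u * x' + c⌋ : ℝ) - ⌊u * x + c⌋) := by
    funext u
    by_cases h : |u - s₀| < ρ
    · have hm : u ∈ Ioo (s₀ - ρ) (s₀ + ρ) := by
        rw [abs_sub_lt_iff] at h; exact ⟨by linarith [h.2], by linarith [h.1]⟩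
      rw [if_pos h, Set.indicator_of_mem hm]
    · have hm : u ∉ Ioo (s₀ - ρ) (s₀ + ρ) := by
        intro hm; exact h (abs_sub_lt_iff.mpr ⟨by linarith [hm.2], by linarith [hm.1]⟩)
      rw [if_neg h, Set.indicator_of_notMem hm]
  rw [heq]
  rw [intervalIntegrable_iff] at hf ⊢
  exact hf.indicator measurableSet_Ioo

/-- The margin is shorter than the period: `r < T` (the first crossing of any form lies in `[r, T)`). -/
theorem margin_lt_period {a : Dir} (hpos : ∀ k, 0 < h28 a k) {T : ℝ} (hT : 0 < T)
    (hper : ∀ k : Fin 28, ∃ z : ℤ, T * h28 a k = z) {δ : Fin 8 → ℝ} {r : ℝ} (hr : 0 < r)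
    (hend : ∀ (k : Fin 28) (z : ℤ), r ≤ |((z : ℝ) - phiForm δ k) / h28 a k|) : r < T := by
  have hx := hpos 0
  obtain ⟨N, hN⟩ := hper 0
  have hN1 : (1 : ℤ) ≤ N := by
    have h0 : (0 : ℝ) < N := by rw [← hN]; positivity
    have h0' : (0 : ℤ) < N := by exact_mod_cast h0
    omega
  have hzmem : ⌊phiForm δ 0⌋ + 1 ∈ Finset.Ioc ⌊phiForm δ 0⌋ (⌊phiForm δ 0⌋ + ⌊T * h28 a 0⌋) := by
    rw [Finset.mem_Ioc, hN, Int.floor_intCast]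
    constructor <;> omega
  obtain ⟨h1, h2⟩ := (mem_crossings_iff hpos hper hr hend 0 _).mp hzmem
  have h := hend 0 (⌊phiForm δ 0⌋ + 1)
  rw [abs_of_pos h1] at h
  linarith

/-- **THE FIRST MOMENTS OF THE JUMPS ARE THE TILT RESPONSE.** Let all 28 forms of `a` be positive, `T > 0` a period, the
translate `δ` generic with margin `r > 0` (`hsep`, `hend` as in the gradient theorem), and let `η` be a tilt of the direction
with `T·|φ_k(η)| ≤ r·h_k(a)/4` for all `k`. Then, with `s_{k,z} = (z − φ_kδ)/h_k(a)` and the jumps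
`J_{k,z} = 𝒩(θ_{s_{k,z}}) − 𝒩(θ_{s_{k,z} − r/2})`:
`∫₀ᵀ [𝒩(u·(s(a) + η) + δ) − 𝒩(u·s(a) + δ)] du = Σ_k (φ_k(η)/(h_k(a) + φ_k(η))) · Σ_{z∈S_k} s_{k,z}·J_{k,z}` — EXACTLY: one period
of the tilted translate differs from the rigid one by the FIRST MOMENTS of the jumps against the relative rate changes. -/
theorem integral_tilt_sub_eq_sum_firstMoment {a : Dir} (hpos : ∀ k, 0 < h28 a k) {T : ℝ} (hT : 0 < T)
    (hper : ∀ k : Fin 28, ∃ z : ℤ, T * h28 a k = z) {δ : Fin 8 → ℝ} {r : ℝ} (hr : 0 < r)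
    (hsep : ∀ (k k' : Fin 28) (z z' : ℤ), (k ≠ k' ∨ z ≠ z') →
      r ≤ |((z : ℝ) - phiForm δ k) / h28 a k - ((z' : ℝ) - phiForm δ k') / h28 a k'|)
    (hend : ∀ (k : Fin 28) (z : ℤ), r ≤ |((z : ℝ) - phiForm δ k) / h28 a k|)
    {η : Fin 8 → ℝ} (hη : ∀ k, T * |phiForm η k| ≤ r * h28 a k / 4) :
    ∫ u in (0 : ℝ)..T, ((torusN (u • (sParam a + η) + δ) : ℝ) - torusN (u • sParam a + δ)) =
      ∑ k : Fin 28, phiForm η k / (h28 a k + phiForm η k) *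
        ∑ z ∈ Finset.Ioc ⌊phiForm δ k⌋ (⌊phiForm δ k⌋ + ⌊T * h28 a k⌋),
          ((z : ℝ) - phiForm δ k) / h28 a k *
            ((torusN ((((z : ℝ) - phiForm δ k) / h28 a k) • sParam a + δ) -
              torusN ((((z : ℝ) - phiForm δ k) / h28 a k - r / 2) • sParam a + δ) : ℤ) : ℝ) := by
  have hrT := margin_lt_period hpos hT hper hr hend
  have hr1 := r_mul_h28_le_one hpos hsep
  -- the tilted rates are positive and close to the straight ones
  have hηk : ∀ k, |phiForm η k| ≤ r * h28 a k / (4 * T) := fun k => by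
    rw [le_div_iff₀ (by positivity)]; linarith [hη k]
  have hx' : ∀ k, 0 < h28 a k + phiForm η k := fun k => by
    have := hηk k; have := neg_abs_le (phiForm η k); have := hpos k
    have : r * h28 a k / (4 * T) < h28 a k := by
      rw [div_lt_iff₀ (by positivity)]; nlinarith
    linarith
  -- pointwise on `[0, T]`: the response to the `u`-dependent displacement `u•η` is the window sum of file (2b)
  have hpt : ∀ u ∈ uIcc (0 : ℝ) T, ((torusN (u • (sParam a + η) + δ) : ℝ) - torusN (u • sParam a + δ)) =
      ∑ k : Fin 28, ∑ z ∈ Finset.Ioc ⌊phiForm δ k⌋ (⌊phiForm δ k⌋ + ⌊T * h28 a k⌋),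
        (if |u - ((z : ℝ) - phiForm δ k) / h28 a k| < r / 2 then
          ((torusN ((((z : ℝ) - phiForm δ k) / h28 a k) • sParam a + δ) -
              torusN ((((z : ℝ) - phiForm δ k) / h28 a k - r / 2) • sParam a + δ) : ℤ) : ℝ) *
            ((⌊u * (h28 a k + phiForm η k) + phiForm δ k⌋ : ℝ) - ⌊u * h28 a k + phiForm δ k⌋)
        else 0) := by
    intro u hu
    rw [uIcc_of_le hT.le] at hu
    have hΔ : ∀ k, |phiForm (u • η) k| ≤ r * h28 a k / 4 := fun k => by
      rw [phiForm_smul, abs_mul, abs_of_nonneg hu.1]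
      calc u * |phiForm η k| ≤ T * |phiForm η k| := mul_le_mul_of_nonneg_right hu.2 (abs_nonneg _)
        _ ≤ _ := hη k
    have h := torusN_sub_eq_sum_windows hpos hper hr hsep hend hΔ hu
    rw [show u • (sParam a + η) + δ = u • sParam a + (δ + u • η) by rw [smul_add]; abel, h]
    refine Finset.sum_congr rfl fun k _ => Finset.sum_congr rfl fun z _ => ?_
    rw [phiForm_smul, show u * h28 a k + phiForm δ k + u * phiForm η k = u * (h28 a k + phiForm η k) + phiForm δ k by ring]
  have hint : ∀ k ∈ (Finset.univ : Finset (Fin 28)), IntervalIntegrable (fun u : ℝ =>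
      ∑ z ∈ Finset.Ioc ⌊phiForm δ k⌋ (⌊phiForm δ k⌋ + ⌊T * h28 a k⌋),
        (if |u - ((z : ℝ) - phiForm δ k) / h28 a k| < r / 2 then
          ((torusN ((((z : ℝ) - phiForm δ k) / h28 a k) • sParam a + δ) -
              torusN ((((z : ℝ) - phiForm δ k) / h28 a k - r / 2) • sParam a + δ) : ℤ) : ℝ) *
            ((⌊u * (h28 a k + phiForm η k) + phiForm δ k⌋ : ℝ) - ⌊u * h28 a k + phiForm δ k⌋)
        else 0)) volume 0 T := by
    intro k _
    have h := IntervalIntegrable.sum (μ := volume) (a := 0) (b := T)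
      (Finset.Ioc ⌊phiForm δ k⌋ (⌊phiForm δ k⌋ + ⌊T * h28 a k⌋))
      (f := fun (z : ℤ) (u : ℝ) => if |u - ((z : ℝ) - phiForm δ k) / h28 a k| < r / 2 then
          ((torusN ((((z : ℝ) - phiForm δ k) / h28 a k) • sParam a + δ) -
              torusN ((((z : ℝ) - phiForm δ k) / h28 a k - r / 2) • sParam a + δ) : ℤ) : ℝ) *
            ((⌊u * (h28 a k + phiForm η k) + phiForm δ k⌋ : ℝ) - ⌊u * h28 a k + phiForm δ k⌋) else 0)
      fun z _ => intervalIntegrable_window_tilt _ _ _ _ _ _ _ _ (hpos k).le (hx' k).le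
    refine h.congr fun u _ => ?_
    simp only [Finset.sum_apply]
  rw [intervalIntegral.integral_congr hpt, intervalIntegral.integral_finsetSum hint]
  refine Finset.sum_congr rfl fun k _ => ?_
  rw [intervalIntegral.integral_finsetSum fun z _ => intervalIntegrable_window_tilt _ _ _ _ _ _ _ _ (hpos k).le
    (hx' k).le, Finset.mul_sum]
  refine Finset.sum_congr rfl fun z hz => ?_
  -- one window
  have hx := hpos k
  set s₀ := ((z : ℝ) - phiForm δ k) / h28 a k with hs₀def
  set s₀' := ((z : ℝ) - phiForm δ k) / (h28 a k + phiForm η k) with hs₀'def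
  set J : ℝ := ((torusN (s₀ • sParam a + δ) - torusN ((s₀ - r / 2) • sParam a + δ) : ℤ) : ℝ) with hJ
  obtain ⟨h1, h2⟩ := (mem_crossings_iff hpos hper hr hend k z).mp hz
  have h0 : r ≤ s₀ := by have h := hend k z; rwa [abs_of_pos h1] at h
  have hT' : s₀ ≤ T - r := by
    have h := crossing_far_from_T hpos hper hend k z; rw [abs_of_neg (by linarith)] at h; linarith
  have hs₀ : s₀ * h28 a k + phiForm δ k = z := by rw [hs₀def, div_mul_cancel₀ _ hx.ne']; ring
  have hs₀' : s₀' * (h28 a k + phiForm η k) + phiForm δ k = z := by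
    rw [hs₀'def, div_mul_cancel₀ _ (hx' k).ne']; ring
  have hzc : (z : ℝ) - phiForm δ k = s₀ * h28 a k := by rw [hs₀def, div_mul_cancel₀ _ hx.ne']
  -- the tilted crossing time stays in the window: `s₀ − s₀' = s₀ φ_kη/(h_k + φ_kη)`
  have hdiff : s₀ - s₀' = s₀ * (phiForm η k / (h28 a k + phiForm η k)) := by
    rw [hs₀'def, hzc]; field_simp [(hx' k).ne']; ring
  have hrat : |phiForm η k / (h28 a k + phiForm η k)| ≤ r / (2 * T) := by
    rw [abs_div, abs_of_pos (hx' k), div_le_div_iff₀ (hx' k) (by positivity)]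
    have := hηk k; have := neg_abs_le (phiForm η k); have := le_abs_self (phiForm η k)
    have hrT4 : r * h28 a k / (4 * T) * (2 * T) = r * h28 a k / 2 := by field_simp; ring
    nlinarith [hr1 k, hpos k]
  have hin : |s₀' - s₀| ≤ r / 2 := by
    rw [abs_sub_comm, hdiff, abs_mul, abs_of_pos h1]
    calc s₀ * |phiForm η k / (h28 a k + phiForm η k)| ≤ T * (r / (2 * T)) :=
          mul_le_mul (by linarith) hrat (abs_nonneg _) hT.le
      _ = r / 2 := by field_simp
  -- the floors stay in the unit cells of `z - 1`, `z` on the window, for both rates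
  have hle : s₀ - r / 2 ≤ s₀ + r / 2 := by linarith
  have hsub : Ioo (s₀ - r / 2) (s₀ + r / 2) ⊆ Ioc 0 T := fun u hu => ⟨by linarith [hu.1], by linarith [hu.2]⟩
  have hηT : ∀ u, |u| ≤ T → |u * phiForm η k| ≤ r * h28 a k / 4 := fun u hu => by
    rw [abs_mul]
    calc |u| * |phiForm η k| ≤ T * |phiForm η k| := mul_le_mul_of_nonneg_right hu (abs_nonneg _)
      _ ≤ _ := hη k
  have hwin : ∀ t : ℝ, |t| ≤ r / 2 → |s₀ + t| ≤ T → (z : ℝ) - 1 ≤ (s₀ + t) * (h28 a k + phiForm η k) + phiForm δ k ∧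
      (s₀ + t) * (h28 a k + phiForm η k) + phiForm δ k < z + 1 := by
    intro t ht hsT
    have e : (s₀ + t) * (h28 a k + phiForm η k) + phiForm δ k = z + (t * h28 a k + (s₀ + t) * phiForm η k) := by
      rw [← hs₀]; ring
    rw [e]
    have h3 := abs_le.mp ht
    have h4 := abs_le.mp (hηT (s₀ + t) hsT)
    have h5 := hr1 k
    constructor <;> nlinarith
  have hwin0 : ∀ t : ℝ, |t| ≤ r / 2 → (z : ℝ) - 1 ≤ (s₀ + t) * h28 a k + phiForm δ k ∧
      (s₀ + t) * h28 a k + phiForm δ k < z + 1 := by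
    intro t ht
    rw [show (s₀ + t) * h28 a k + phiForm δ k = z + t * h28 a k by rw [← hs₀]; ring]
    have h3 := abs_le.mp ht
    have h5 := hr1 k
    constructor <;> nlinarith
  have hTlo : |s₀ + -(r / 2)| ≤ T := by rw [abs_of_nonneg (by linarith)]; linarith
  have hThi : |s₀ + r / 2| ≤ T := by rw [abs_of_nonneg (by linarith)]; linarith
  have hrabs : |(r / 2)| ≤ r / 2 := by rw [abs_of_nonneg (by linarith)]
  have hrabs' : |(-(r / 2))| ≤ r / 2 := by rw [abs_neg, abs_of_nonneg (by linarith)]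
  obtain ⟨⟨hlo', -⟩, ⟨-, hhi'⟩⟩ := And.intro (hwin (-(r / 2)) hrabs' hTlo) (hwin (r / 2) hrabs hThi)
  obtain ⟨⟨hlo, -⟩, ⟨-, hhi⟩⟩ := And.intro (hwin0 (-(r / 2)) hrabs') (hwin0 (r / 2) hrabs)
  -- integrate the window term
  have e1 : (fun u : ℝ => if |u - s₀| < r / 2 then
      J * ((⌊u * (h28 a k + phiForm η k) + phiForm δ k⌋ : ℝ) - ⌊u * h28 a k + phiForm δ k⌋) else 0) =
      (Ioo (s₀ - r / 2) (s₀ + r / 2)).indicator fun u =>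
        J * ((⌊u * (h28 a k + phiForm η k) + phiForm δ k⌋ : ℝ) - ⌊u * h28 a k + phiForm δ k⌋) := by
    funext u
    by_cases h : |u - s₀| < r / 2
    · have hm : u ∈ Ioo (s₀ - r / 2) (s₀ + r / 2) := by
        rw [abs_sub_lt_iff] at h; exact ⟨by linarith [h.2], by linarith [h.1]⟩
      rw [if_pos h, Set.indicator_of_mem hm]
    · have hm : u ∉ Ioo (s₀ - r / 2) (s₀ + r / 2) := by
        intro hm; exact h (abs_sub_lt_iff.mpr ⟨by linarith [hm.2], by linarith [hm.1]⟩)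
      rw [if_neg h, Set.indicator_of_notMem hm]
  rw [e1, intervalIntegral.integral_of_le hT.le, setIntegral_indicator measurableSet_Ioo,
    Set.inter_eq_self_of_subset_right hsub, ← integral_Ioc_eq_integral_Ioo, ← intervalIntegral.integral_of_le hle,
    intervalIntegral.integral_const_mul, integral_window_tilt hx (hx' k) hs₀ hs₀' (by linarith) hin
      (by rw [show (s₀ - r / 2) = s₀ + -(r / 2) by ring]; exact hlo) hhi
      (by rw [show (s₀ - r / 2) = s₀ + -(r / 2) by ring]; exact hlo') hhi', hdiff, hJ]
  ring

/-- `|m_k(δ)| ≤ T·(T·h_k(a))`: every crossing position is `≤ T` and every jump is `0/±1`. -/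
theorem abs_firstMoment_le {a : Dir} (hpos : ∀ k, 0 < h28 a k) {T : ℝ} (hT : 0 < T)
    (hper : ∀ k : Fin 28, ∃ z : ℤ, T * h28 a k = z) {δ : Fin 8 → ℝ} {r : ℝ} (hr : 0 < r)
    (hsep : ∀ (k k' : Fin 28) (z z' : ℤ), (k ≠ k' ∨ z ≠ z') →
      r ≤ |((z : ℝ) - phiForm δ k) / h28 a k - ((z' : ℝ) - phiForm δ k') / h28 a k'|)
    (hend : ∀ (k : Fin 28) (z : ℤ), r ≤ |((z : ℝ) - phiForm δ k) / h28 a k|) (k : Fin 28) :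
    |∑ z ∈ Finset.Ioc ⌊phiForm δ k⌋ (⌊phiForm δ k⌋ + ⌊T * h28 a k⌋),
        ((z : ℝ) - phiForm δ k) / h28 a k *
          ((torusN ((((z : ℝ) - phiForm δ k) / h28 a k) • sParam a + δ) -
            torusN ((((z : ℝ) - phiForm δ k) / h28 a k - r / 2) • sParam a + δ) : ℤ) : ℝ)| ≤ T * (T * h28 a k) := by
  obtain ⟨N, hN⟩ := hper k
  have hNf : ⌊T * h28 a k⌋ = N := by rw [hN, Int.floor_intCast]
  have hN0 : 0 ≤ N := by have : (0 : ℝ) ≤ N := (by rw [← hN]; have := hpos k; positivity); exact_mod_cast this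
  refine (Finset.abs_sum_le_sum_abs _ _).trans ?_
  have hterm : ∀ z ∈ Finset.Ioc ⌊phiForm δ k⌋ (⌊phiForm δ k⌋ + ⌊T * h28 a k⌋),
      |((z : ℝ) - phiForm δ k) / h28 a k *
          ((torusN ((((z : ℝ) - phiForm δ k) / h28 a k) • sParam a + δ) -
            torusN ((((z : ℝ) - phiForm δ k) / h28 a k - r / 2) • sParam a + δ) : ℤ) : ℝ)| ≤ T := by
    intro z hz
    obtain ⟨h1, h2⟩ := (mem_crossings_iff hpos hper hr hend k z).mp hz
    have hJ : |((torusN ((((z : ℝ) - phiForm δ k) / h28 a k) • sParam a + δ) -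
        torusN ((((z : ℝ) - phiForm δ k) / h28 a k - r / 2) • sParam a + δ) : ℤ) : ℝ)| ≤ 1 := by
      have hsep' : ∀ (k' : Fin 28) (z' : ℤ), k' ≠ k →
          r ≤ |((z : ℝ) - phiForm δ k) / h28 a k - ((z' : ℝ) - phiForm δ k') / h28 a k'| :=
        fun k' z' hk' => hsep k k' z z' (Or.inl (Ne.symm hk'))
      by_cases hk : k ∈ FIdx
      · obtain ⟨h3, h4⟩ := jump_mem_of_FIdx hpos hr (r_mul_h28_le_one hpos hsep k) hsep' hk
        have h3' : (0 : ℝ) ≤ ((torusN ((((z : ℝ) - phiForm δ k) / h28 a k) • sParam a + δ) -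
            torusN ((((z : ℝ) - phiForm δ k) / h28 a k - r / 2) • sParam a + δ) : ℤ) : ℝ) := by exact_mod_cast h3
        have h4' : ((torusN ((((z : ℝ) - phiForm δ k) / h28 a k) • sParam a + δ) -
            torusN ((((z : ℝ) - phiForm δ k) / h28 a k - r / 2) • sParam a + δ) : ℤ) : ℝ) ≤ 1 := by exact_mod_cast h4
        rw [abs_le]; constructor <;> linarith
      · obtain ⟨h3, h4⟩ := jump_mem_of_not_FIdx hpos hr (r_mul_h28_le_one hpos hsep k) hsep' hk
        have h3' : (-1 : ℝ) ≤ ((torusN ((((z : ℝ) - phiForm δ k) / h28 a k) • sParam a + δ) -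
            torusN ((((z : ℝ) - phiForm δ k) / h28 a k - r / 2) • sParam a + δ) : ℤ) : ℝ) := by exact_mod_cast h3
        have h4' : ((torusN ((((z : ℝ) - phiForm δ k) / h28 a k) • sParam a + δ) -
            torusN ((((z : ℝ) - phiForm δ k) / h28 a k - r / 2) • sParam a + δ) : ℤ) : ℝ) ≤ 0 := by exact_mod_cast h4
        rw [abs_le]; constructor <;> linarith
    rw [abs_mul, abs_of_pos h1]
    calc ((z : ℝ) - phiForm δ k) / h28 a k * _ ≤ T * 1 := mul_le_mul h2.le hJ (abs_nonneg _) hT.le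
      _ = T := mul_one T
  refine (Finset.sum_le_card_nsmul _ _ T hterm).trans ?_
  rw [hNf, Int.card_Ioc, show ⌊phiForm δ k⌋ + N - ⌊phiForm δ k⌋ = N by ring, nsmul_eq_mul, hN,
    ← Int.cast_natCast N.toNat, Int.toNat_of_nonneg hN0]
  linarith


/-- **NO CANCELLATION RECOVERS THE DRIFT BOUND**: `|∫₀ᵀ [𝒩(u·(s(a)+η)+δ) − 𝒩(u·s(a)+δ)] du| ≤ (4/3)·T²·Σ_k |φ_k(η)|` — the
tilt theorem with every first moment at its maximum `T·(T·h_k)` (and `h_k + φ_kη ≥ (3/4)h_k`); anything better is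
CANCELLATION in the first moments (DATA, in no statement). -/
theorem abs_integral_tilt_sub_le {a : Dir} (hpos : ∀ k, 0 < h28 a k) {T : ℝ} (hT : 0 < T)
    (hper : ∀ k : Fin 28, ∃ z : ℤ, T * h28 a k = z) {δ : Fin 8 → ℝ} {r : ℝ} (hr : 0 < r)
    (hsep : ∀ (k k' : Fin 28) (z z' : ℤ), (k ≠ k' ∨ z ≠ z') →
      r ≤ |((z : ℝ) - phiForm δ k) / h28 a k - ((z' : ℝ) - phiForm δ k') / h28 a k'|)
    (hend : ∀ (k : Fin 28) (z : ℤ), r ≤ |((z : ℝ) - phiForm δ k) / h28 a k|)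
    {η : Fin 8 → ℝ} (hη : ∀ k, T * |phiForm η k| ≤ r * h28 a k / 4) :
    |∫ u in (0 : ℝ)..T, ((torusN (u • (sParam a + η) + δ) : ℝ) - torusN (u • sParam a + δ))| ≤
      4 / 3 * T ^ 2 * ∑ k : Fin 28, |phiForm η k| := by
  have hrT := margin_lt_period hpos hT hper hr hend
  rw [integral_tilt_sub_eq_sum_firstMoment hpos hT hper hr hsep hend hη, Finset.mul_sum]
  refine (Finset.abs_sum_le_sum_abs _ _).trans (Finset.sum_le_sum fun k _ => ?_)
  have hx := hpos k
  have hφ : |phiForm η k| ≤ h28 a k / 4 := by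
    have hrh : r * h28 a k ≤ T * h28 a k := mul_le_mul_of_nonneg_right hrT.le hx.le
    have h1 : T * |phiForm η k| ≤ T * (h28 a k / 4) := by linarith [hη k]
    exact le_of_mul_le_mul_left h1 hT
  have hden : 3 / 4 * h28 a k ≤ h28 a k + phiForm η k := by linarith [neg_abs_le (phiForm η k)]
  have hden0 : 0 < 3 / 4 * h28 a k := by positivity
  have hm := abs_firstMoment_le hpos hT hper hr hsep hend k
  rw [abs_mul, abs_div, abs_of_pos (hden0.trans_le hden)]
  calc |phiForm η k| / (h28 a k + phiForm η k) * _ ≤ |phiForm η k| / (3 / 4 * h28 a k) * (T * (T * h28 a k)) :=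
        mul_le_mul (div_le_div_of_nonneg_left (abs_nonneg _) hden0 hden) hm (abs_nonneg _) (by positivity)
    _ = 4 / 3 * T ^ 2 * |phiForm η k| := by field_simp


/-! ### One period of the perturbed orbit = rigid translate + tilt, exactly -/

/-- **ONE PERIOD OF THE PERTURBED ORBIT = RIGID TRANSLATE DEFECT + FIRST-MOMENT TILT, EXACTLY.** For the perturbed direction
`a' = aOfS(s(a) + η)` and the `n`-th period, with the rigid translate `δ_n = (n·T)·η`: if `δ_n` is generic with margin `r`
(`hsep`, `hend` at `δ_n`) and `T·|φ_k η| ≤ r·h_k(a)/4`, then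
`∫_{nT}^{(n+1)T} [𝒩(u·s(a')) − 𝒩(u·s(a))] du = [P(δ_n) − P(0)] + Σ_k (φ_k(η)/(h_k + φ_k(η)))·m_k(δ_n)` — the desk note's
`B_n + A_n` split of one period, unweighted, BOTH parts finite expressions in the jumps of the translated orbit. NON-VACUOUS only
when `δ_n` has the margin: `hend` at `z = 0` forces `n·T·|φ_kη| ≥ r·h_k`, so `n ≥ 4` here — the first periods (the coherence
regime of the closed orbit's junctions, P2 g19–g33) are NOT covered by this statement. -/
theorem period_integral_eq_translate_add_tilt {a : Dir} (hpos : ∀ k, 0 < h28 a k) {T : ℝ} (hT : 0 < T)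
    (hper : ∀ k : Fin 28, ∃ z : ℤ, T * h28 a k = z) {η : Fin 8 → ℝ} (n : ℕ) {r : ℝ} (hr : 0 < r)
    (hsep : ∀ (k k' : Fin 28) (z z' : ℤ), (k ≠ k' ∨ z ≠ z') →
      r ≤ |((z : ℝ) - phiForm (((n : ℝ) * T) • η) k) / h28 a k - ((z' : ℝ) - phiForm (((n : ℝ) * T) • η) k') / h28 a k'|)
    (hend : ∀ (k : Fin 28) (z : ℤ), r ≤ |((z : ℝ) - phiForm (((n : ℝ) * T) • η) k) / h28 a k|)
    (hη : ∀ k, T * |phiForm η k| ≤ r * h28 a k / 4) :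
    ∫ u in ((n : ℝ) * T)..(((n : ℝ) + 1) * T),
        ((torusN (u • sParam (aOfS (sParam a + η))) : ℝ) - torusN (u • sParam a)) =
      (translateIntegral a T (((n : ℝ) * T) • η) - translateIntegral a T 0) +
      ∑ k : Fin 28, phiForm η k / (h28 a k + phiForm η k) *
        ∑ z ∈ Finset.Ioc ⌊phiForm (((n : ℝ) * T) • η) k⌋ (⌊phiForm (((n : ℝ) * T) • η) k⌋ + ⌊T * h28 a k⌋),
          ((z : ℝ) - phiForm (((n : ℝ) * T) • η) k) / h28 a k *
            ((torusN ((((z : ℝ) - phiForm (((n : ℝ) * T) • η) k) / h28 a k) • sParam a + ((n : ℝ) * T) • η) -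
              torusN ((((z : ℝ) - phiForm (((n : ℝ) * T) • η) k) / h28 a k - r / 2) • sParam a +
                ((n : ℝ) * T) • η) : ℤ) : ℝ) := by
  set δn : Fin 8 → ℝ := ((n : ℝ) * T) • η with hδn
  rw [← integral_tilt_sub_eq_sum_firstMoment hpos hT hper hr hsep hend hη, translateIntegral_sub, sParam_aOfS,
    ← intervalIntegral.integral_add ((intervalIntegrable_torusN_line a δn 0 T).sub (intervalIntegrable_torusN_line a 0 0 T))
      (((intervalIntegrable_torusN_line (aOfS (sParam a + η)) δn 0 T).congr fun u _ => by rw [sParam_aOfS]).sub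
      (intervalIntegrable_torusN_line a δn 0 T))]
  -- shift the period to `[0, T]`
  have h := intervalIntegral.integral_comp_add_right (a := 0) (b := T)
    (fun u : ℝ => (torusN (u • (sParam a + η)) : ℝ) - torusN (u • sParam a)) ((n : ℝ) * T)
  rw [zero_add, show T + (n : ℝ) * T = ((n : ℝ) + 1) * T by ring] at h
  rw [← h]
  refine intervalIntegral.integral_congr fun u _ => ?_
  have e1 : (u + (n : ℝ) * T) • (sParam a + η) = (u + n * T) • sParam a + (u • η + δn) := by
    simp only [hδn, smul_add, add_smul]
  have h1 : torusN ((u + (n : ℝ) * T) • (sParam a + η)) = torusN (u • (sParam a + η) + δn) := by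
    rw [e1, torusN_line_add_nat_mul_period hper (u • η + δn) u n]
    congr 1; rw [smul_add]; abel
  have h2 : torusN ((u + (n : ℝ) * T) • sParam a) = torusN (u • sParam a) := by
    simpa using torusN_line_add_nat_mul_period hper 0 u n
  rw [h1, h2, add_zero]
  ring

end Summit.KontsevichZagierPeriods.Zeta5Search.Barrier.ConeGamma

end
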